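import Summits.CriticalPhenomena.PercolationContinuityZ3.Theorems.PercNearOneGluingNoHeavyLowerTailEGDetachmentTransfer
import Summits.CriticalPhenomena.PercolationContinuityZ3.Theorems.PercNearOneGluingNoHeavyLowerTailCILRelayGluing
import Summits.CriticalPhenomena.PercolationContinuityZ3.Theorems.PercNearOneGluingAdditiveGluingTieLiftTwoAux
import Literature.Probability.Percolation.KozmaNitzanGoodQuadruple
import HarnessLib

/-!
# Kozma–Nitzan GOODNESS is monotone under raising relay hairs AT THE OBSERVER — tools
# (`NoHeavyLowerTail` cell, stmt-CriticalPhenomena-4575; prover `prim-hp-2`, deletion–contraction line, gen 3)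

Support file (`--supports stmt-CriticalPhenomena-4575`).  No definitions, no named facts, no sorries.
`μ_w = prodBernoulli w` on `Fin n`; for a pair `e`, `w[e ↦ u]` is `Function.update w e u`.

* `KNGoodHair.real_update_eq_of_preimage_insert_eq` — an `e`-insensitive event (`(insert e)⁻¹' S = S`) has the same probability
  under every `w[e ↦ u]` (one-bond decomposition `stub_oneBondDecomp_k15` + `tieLiftOne_real_one_eq`); pull-backs along
  `ω ↦ insert e ω` are read through the tree's `tieLiftTwo_real_update_one` (`μ_{w[e↦1]}(S) = μ_w((insert e)⁻¹' S)`, any `w`).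
* `KNGoodHair.glueTransfer_not_openConn` — **in-graph pair-gluing transfer** (Kozma–Nitzan's Lemma 5 for the star `{v,p}` of an
  auxiliary hub, derived here from the detachment two-observer transfer `EGTransfer.twoObserver_detach_le` = van den
  Berg–Häggström–Kahn Thm 1.5): if `μ_w(p ↮ b) ≤ μ_w(a ↮ b)` (the vertex `a` is at most as connected to `b` as `p`, IN `w`), then
  after gluing `v` to `p`, `μ_{w[s(v,p)↦1]}(v ↮ b) ≤ μ_{w[s(v,p)↦1]}(a ↮ b)`.  No hypothesis on `w s(v,p)`, on `v`'s other pairs,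
  or on `a, p` being relays.
-/

noncomputable section

namespace Summit.CriticalPhenomena.PercolationContinuityZ3.Theorems

open MeasureTheory Set Literature.Probability.LatticeModels Literature.Probability.Percolation
open scoped Classical BigOperators

variable {n : ℕ}

namespace KNGoodHair

open ChampionStability

/-- An event insensitive to the pair `e` (`(insert e)⁻¹' S = S`) has the same probability under every `w[e ↦ u]`.
[folklore] -/
theorem real_update_eq_of_preimage_insert_eq (w : Sym2 (Fin n) → unitInterval) (e : Sym2 (Fin n))
    (S : Set (BondConfig (Fin n))) (hS : (fun ω : BondConfig (Fin n) => insert e ω) ⁻¹' S = S) (u : unitInterval) :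
    (prodBernoulli (Function.update w e u)).real S = (prodBernoulli (Function.update w e 0)).real S := by
  have hdec := stub_oneBondDecomp_k15 n (Function.update w e u) e S
  rw [Function.update_idem, Function.update_idem, Function.update_self] at hdec
  have h1 : (prodBernoulli (Function.update w e 1)).real S = (prodBernoulli (Function.update w e 0)).real S := by
    rw [tieLiftOne_real_one_eq w e S, hS]
  rw [h1] at hdec
  rw [hdec]; ring

/-- **In-graph pair-gluing transfer.**  For vertices `v ≠ p` and `a, b`: if `μ_w(p ↮ b) ≤ μ_w(a ↮ b)` then
`μ_{w[s(v,p)↦1]}(v ↮ b) ≤ μ_{w[s(v,p)↦1]}(a ↮ b)`.  Pull back along `ω ↦ ω ∪ {s(v,p)}`: on `{a ↔ v or a ↔ p}` the pulled-back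
event `{v ↮ b, p ↮ b}` forces `{a ↮ b}`; off it the two sides are those of `EGTransfer.twoObserver_detach_le` with
`(x, y, c) = (v, p, a)`.  (Kozma–Nitzan's Lemma 5 with an auxiliary hub glued to `{v, p}`; here the comparison is made in `w`
itself, with all other pairs at `v` random.)
[cite: VandenbergHaggstromKahn2005, Thm. 1.5 (p. 7) — via `EGTransfer.twoObserver_detach_le`; KozmaNitzan2024, Lemma 5 (p. 13)] -/
theorem glueTransfer_not_openConn (w : Sym2 (Fin n) → unitInterval) (v p a b : Fin n) (hvp : v ≠ p)
    (hle : (prodBernoulli w).real (openConn p b : Set (BondConfig (Fin n)))ᶜ ≤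
      (prodBernoulli w).real (openConn a b : Set (BondConfig (Fin n)))ᶜ) :
    (prodBernoulli (Function.update w s(v, p) 1)).real (openConn v b : Set (BondConfig (Fin n)))ᶜ ≤
      (prodBernoulli (Function.update w s(v, p) 1)).real (openConn a b : Set (BondConfig (Fin n)))ᶜ := by
  set μ := prodBernoulli w with hμ
  have hmeas : ∀ S : Set (BondConfig (Fin n)), MeasurableSet S := fun S => (Set.toFinite S).measurableSet
  rw [tieLiftTwo_real_update_one w s(v, p), tieLiftTwo_real_update_one w s(v, p)]
  set L' : Set (BondConfig (Fin n)) := (fun ω : BondConfig (Fin n) => insert s(v, p) ω) ⁻¹'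
      (openConn v b : Set (BondConfig (Fin n)))ᶜ with hL'
  set R' : Set (BondConfig (Fin n)) := (fun ω : BondConfig (Fin n) => insert s(v, p) ω) ⁻¹'
      (openConn a b : Set (BondConfig (Fin n)))ᶜ with hR'
  set C : Set (BondConfig (Fin n)) := {ω | (openGraph ω).Reachable a v ∨ (openGraph ω).Reachable a p} with hC
  have hL'eq : L' = {ω : BondConfig (Fin n) | ω ∉ openConn v b ∧ ω ∉ openConn p b} := by
    ext ω
    simp only [hL', mem_preimage, mem_compl_iff, mem_setOf_eq]
    have hvb : insert s(v, p) ω ∈ openConn v b ↔ (ω ∈ openConn v b ∨ ω ∈ openConn p b) :=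
      reachable_insert_left_iff ω hvp b
    rw [hvb, not_or]
  -- on `C`: inclusion
  have hinC : L' ∩ C ⊆ R' ∩ C := by
    rintro ω ⟨hωL, hωC⟩
    rw [hL'eq] at hωL
    obtain ⟨hvb, hpb⟩ := hωL
    refine ⟨?_, hωC⟩
    simp only [hR', mem_preimage, mem_compl_iff]
    show ¬ (openGraph (insert s(v, p) ω)).Reachable a b
    rw [reachable_insert_iff ω hvp a b]
    rintro (h | ⟨-, ⟨s, hs, hsb⟩⟩)
    · rcases hωC with hav | hap
      · exact hvb (hav.symm.trans h)
      · exact hpb (hap.symm.trans h)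
    · simp only [Finset.mem_insert, Finset.mem_singleton] at hs
      rcases hs with rfl | rfl
      · exact hvb hsb
      · exact hpb hsb
  -- off `C`: the detachment two-observer transfer
  have hoffL : L' \ C ⊆ {ω : BondConfig (Fin n) | ω ∉ openConn a v ∧ ω ∉ openConn a p ∧ ω ∉ openConn p b} := by
    rintro ω ⟨hωL, hωC⟩
    rw [hL'eq] at hωL
    simp only [hC, mem_setOf_eq, not_or] at hωC
    exact ⟨hωC.1, hωC.2, hωL.2⟩
  have hoffR : {ω : BondConfig (Fin n) | ω ∉ openConn a v ∧ ω ∉ openConn a p ∧ ω ∉ openConn a b} = R' \ C := by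
    ext ω
    simp only [hR', hC, mem_sdiff, mem_preimage, mem_compl_iff, mem_setOf_eq, not_or]
    constructor
    · rintro ⟨hav, hap, hab⟩
      refine ⟨?_, hav, hap⟩
      show ¬ (openGraph (insert s(v, p) ω)).Reachable a b
      rw [reachable_insert_iff_of_not ω hvp hav hap b]
      exact hab
    · rintro ⟨hab, hav, hap⟩
      refine ⟨hav, hap, ?_⟩
      intro h
      apply hab
      show (openGraph (insert s(v, p) ω)).Reachable a b
      rw [reachable_insert_iff_of_not ω hvp hav hap b]
      exact h
  have hT := EGTransfer.twoObserver_detach_le w v p a b hle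
  have hsplitL : μ.real (L' ∩ C) + μ.real (L' \ C) = μ.real L' := measureReal_inter_add_sdiff (hmeas C)
  have hsplitR : μ.real (R' ∩ C) + μ.real (R' \ C) = μ.real R' := measureReal_inter_add_sdiff (hmeas C)
  have h1 : μ.real (L' ∩ C) ≤ μ.real (R' ∩ C) := measureReal_mono hinC
  have h2 : μ.real (L' \ C) ≤ μ.real (R' \ C) := by
    rw [← hoffR]
    exact (measureReal_mono hoffL).trans hT
  linarith

/-- **In-graph pair-gluing transfer, connection form**: if `μ_w(a ↔ b) ≤ μ_w(p ↔ b)` then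
`μ_{w[s(v,p)↦1]}(a ↔ b) ≤ μ_{w[s(v,p)↦1]}(v ↔ b)`. [cite: VandenbergHaggstromKahn2005, Thm. 1.5 (p. 7); KozmaNitzan2024, Lemma 5 (p. 13)] -/
theorem glueTransfer_openConn (w : Sym2 (Fin n) → unitInterval) (v p a b : Fin n) (hvp : v ≠ p)
    (hle : (prodBernoulli w).real (openConn a b) ≤ (prodBernoulli w).real (openConn p b)) :
    (prodBernoulli (Function.update w s(v, p) 1)).real (openConn a b) ≤
      (prodBernoulli (Function.update w s(v, p) 1)).real (openConn v b) := by
  haveI : ∀ u : Sym2 (Fin n) → unitInterval, IsProbabilityMeasure (prodBernoulli u) := fun u => inferInstance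
  have hmeas : ∀ S : Set (BondConfig (Fin n)), MeasurableSet S := fun S => (Set.toFinite S).measurableSet
  have hc1 := probReal_compl_eq_one_sub (μ := prodBernoulli w) (hmeas (openConn a b))
  have hc2 := probReal_compl_eq_one_sub (μ := prodBernoulli w) (hmeas (openConn p b))
  have hc3 := probReal_compl_eq_one_sub (μ := prodBernoulli (Function.update w s(v, p) 1)) (hmeas (openConn a b))
  have hc4 := probReal_compl_eq_one_sub (μ := prodBernoulli (Function.update w s(v, p) 1)) (hmeas (openConn v b))
  have h := glueTransfer_not_openConn w v p a b hvp (by rw [hc1, hc2]; linarith)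
  rw [hc3, hc4] at h
  linarith

end KNGoodHair

end Summit.CriticalPhenomena.PercolationContinuityZ3.Theorems

end
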